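import Mathlib.Analysis.Complex.Schwarz
import Literature.MathematicalPhysics.QuantumFieldTheory.Balaban1983to89.B13Lemma3TorusNonvacuity
import Summits.QuantumFields.BalabanUV.T4Continuum.Spine.NE1p.DressedOutputAnalytic

/-!
# Spine/NE5/TwoRunTorusRate — row NE5's MECHANISM END TO END on the papers' periodic carrier, from the (2.26) layer up:
# (2.26) uniform along a holomorphic pencil of (2.14)-terms joining the two runs ⇒ the two-run rate of `H(Z)` and of
# `E^{(k+1)}(X)` at one paired scale (cell `pub-balaban-gaps`, seat `ne5` gen 7)

WHY (row NE5 = `T4OutputRate.NE5`, triage sheet `HOME/ne/NE5.md` §4 (M2) ∕ §7 (G-c) ∕ census B8, T3, T8–T13, T11).  NE5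
compares ONE step's output at two lattice spacings (run A: η, read through the block-averaging transport; run B: η∕L) on
the SAME unit torus: `|E^{(j),A}(X) − E^{(j+1),B}(X)| ≤ C₅θ^j e^{−κd_j(X)}`.  The cell's mechanism (King, CMP **102**
p. 665 *"the error is the same graph with a difference of propagators on one line"* + Cauchy in the inputs): join the
two runs' data by a complex PENCIL `θ ↦ data_A + θ·(data_B − data_A)`, show the one-run bound holds UNIFORMLY on the
parameter disc `‖θ‖ < ρ`, `ρ = s∕r_j` (margin `s` over the termwise two-run rate `r_j` of rows NE2∕NE3 — gens 5–6:
`TwoRunPencilWalks.jointWalkExpansion_pencil_reach`, `TwoRunPencilGlue`, `NeumannPencilCovariance`, `B13Core214Holomorphic`,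
`B13Bound226LocatedPoly`), and read the rate off the Cauchy ∕ Schwarz estimate `‖f(1) − f(0)‖ ≤ 2M∕ρ`.  Until now the
tree held the two ends separately: the CLASS along the pencil one layer below the activities (T8–T13, H1–H7) and the
abstract E-layer Cauchy estimate on the lineage's step-model sockets (`Spine/NE5/EnvelopeFromActivities`).  THIS FILE
closes the chain ON THE CONCRETE CARRIER where the tree has Lemma 3 → Theorem I.3 end to end from (2.26)
(`B13Lemma3TorusTerms.bound238_torus_of_226`, `TreeLengthTorusGeometry.deliverables_torus_four`): the two-scale TORUS
model `B13Lemma3Torus.TwoTorusStep` ([I] p. 251 periodic carrier, 𝐃_k = `tsys 4 (L·N′)`, 𝐃_{k+1} = `tsys 4 N′`).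

CONTENT (0 `def`, 0 sorry).
* §1 `norm_sub_le_of_pencil` — the one-line Cauchy step NE5 consumes, = Mathlib's Schwarz lemma
  (`Complex.dist_le_div_mul_dist_of_mapsTo_ball`): `f` holomorphic on `ball 0 ρ`, `ρ > 1`, `‖f‖ ≤ M` there ⇒
  `‖f 1 − f 0‖ ≤ 2M∕ρ`; `norm_smul_sub_le_of_pencil`: the rescaled difference `(ρ∕2)·(f 1 − f 0)` obeys the SAME majorant `M`.
* §2 `norm_locE_sub_le_of_pencil` — GENERIC E-LAYER TWO-RUN RATE over ANY polymer geometry in the [KP86] region (the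
  hypothesis list of ne1's `NE1p.DressedOutputAnalytic.analytic_and_bounded_locE_param`, parameter space `ℂ`): a pencil of
  activity families `θ ↦ H^θ(Z)` holomorphic on `ball 0 ρ` with the (2.38)-shape majorant `A e^{−R d(Z)}` UNIFORM in `θ`
  ⇒ `‖locE(H^1)(X) − locE(H^0)(X)‖ ≤ (2∕ρ)·e ν c₁ K₀² A e^{−r₁ d(X)}` — the (2.41) envelope times `2∕ρ`.
* §3 ON THE TORUS MODEL (d = 4, L = `c.L` ≥ 8, cube side M): the two runs' (2.14)-TERM families are the end points
  `P(·, 0)`, `P(·, 1)` of a pencil `θ ↦ P Z t φ θ` holomorphic on `ball 0 ρ` along which (2.26) holds UNIFORMLY —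
  `‖P Z t φ θ‖ ≤ weight L M c Z a t · e^{a₅|Z|}` for `‖θ‖ < ρ` (what `B13Lemma3TorusPrimitivePoly.h226_torus_of_primitives_holo_polyτ`
  delivers at each `θ` from the primitive objects).  Then, under Lemma 3's numerical restrictions VERBATIM those of
  `bound238_torus_of_226`:
  - `bound238_torus_pencil`: (2.38) for EVERY pencil member `H^θ(Z) = Σ_{t ∈ terms Z} P Z t φ θ`;
  - `norm_H_sub_le_torus`: H-LAYER RATE `‖H^B(Z) − H^A(Z)‖ ≤ (2∕ρ)·C₃ε₁e^{−(1−8δ)½Lκ d_{k+1}(Z)}` on `sp2 Z`;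
  - `norm_E_sub_le_torus`: with (2.13) `E = locE H` for each run, the space restriction p. 15 and the (2.39)–(2.41)
    numbers of `B13Resummation.cammarotaStep_of_KP` (torus constants ν = 9, c₁ = 64, K₀(64,8), κ₀ = 64 log 162):
    E-LAYER RATE `‖E^B(X) − E^A(X)‖ ≤ (2∕ρ)·A₂C₃ε₁e^{−(1−10δ)½Lκ d_{k+1}(X)}` on `sp2 X` — the SHAPE of the typed
    (NOT printed) estimate `T4OutputRate.NE5` AT ONE PAIRED SCALE on the torus carrier, `C₅θ^j := (2r_j∕s)·A₂C₃ε₁` (`ρ = s∕r_j`);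
  - `numerics_nonvacuous_pencil`: the NUMERICAL side conditions of `norm_E_sub_le_torus` (Lemma 3's restrictions + the
    (2.39)–(2.41) numbers with the exponent `5(1−10δ)½Lκ + 1`) are jointly satisfiable — the tree witness
    `B13Lemma3TorusNonvacuity.numerics_nonvacuous` read through R22 `(1−10δ)½L = 1`.
LEDGER MEANING.  Between «(2.26) uniform along a holomorphic term pencil» and «NE5 at scale j» no further input exists:
every resummation, Kotecký–Preiss and Cauchy step is a theorem on the carrier.  What the pencil hypothesis costs is
exactly the located items of `ne/NE5.md`: the CLASS along the pencil (T8–T13: walk objects; T11∕H4–H7: the formula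
layer's holomorphy and (2.26) from primitives per member) + NODE O's per-run local walk data + W1 (rows NE2∕NE3, the
termwise local rate `r_j`).  The θ^j of NE5 is `r_j`; the geometric profile is rows NE2∕NE3's, the constant `2A₂C₃ε₁∕s`.

HONEST FRAMING.  Bookkeeping + one-variable complex analysis over LANDED shapes (`TwoTorusStep`, `terms`, `weight`,
`locE`, `tgeometry`); the pencil `P`, its radius `ρ`, the two runs' `H`, `E` and every constant are HYPOTHESES ∕
parameters; nothing of Bałaban's is constructed or asserted (whether his (2.14)-terms at two spacings admit such a
pencil is NODE O + rows NE2∕NE3, instance 0∕1); NE5 NOT PRINTED ∕ NOT PROVED; 0∕12 NE5 leaves on Bałaban's objects;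
(D4) NOT discharged.  Rung (B)+1 on a FIXED finite T⁴ — NOT continuum by itself, NOT infinite volume, NOT mass gap,
NOT Clay.  Spine PROVED 0∕9.  HONEST DEPENDENCY: continuum YM on T⁴ ⇐ BetaPertH ∧ nine spine estimates; BetaPertH ⇐
(D1) ∧ (D4) ∧ CAP+tail.

Sources: [II] = T. Bałaban, CMP **116** (1988) 1–22 [Balaban1988RG2Cluster] (2.13)–(2.14) pp. 14–15, (2.26) p. 17,
Lemma 3 (2.38) p. 20, (2.39)–(2.41) p. 21; [I] = CMP **109** (1987) [Balaban1987RG1] p. 251 (carrier), (0.25) p. 257;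
C. King, CMP **102** (1986) [King1986] Thm 3.4 p. 656, p. 665 (the template rate); R. Kotecký, D. Preiss, CMP **103**
(1986) [KoteckyPreiss1986].  Nothing here is a claim about the Yang–Mills mass gap.
-/

noncomputable section

namespace Summit.QuantumFields.BalabanUV.T4Continuum.Spine.NE5.TwoRunTorusRate

open Metric Set Finset
open Literature.MathematicalPhysics.QuantumFieldTheory.Balaban1983to89
open Literature.MathematicalPhysics.QuantumFieldTheory.Balaban1983to89.TreeLengthTorus (TPt TDom tsys)
open Literature.MathematicalPhysics.QuantumFieldTheory.Balaban1983to89.TreeLengthTorusGeometry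
  (TTouch tgeometry tgeometry_consts_four)
open Literature.MathematicalPhysics.QuantumFieldTheory.Balaban1983to89.B13Lemma3TorusData (TBond)
open Literature.MathematicalPhysics.QuantumFieldTheory.Balaban1983to89.B13Lemma3Torus (TwoTorusStep)
open Literature.MathematicalPhysics.QuantumFieldTheory.Balaban1983to89.B13Lemma3TorusTerms
  (terms weight bound238_torus_of_226)
open Literature.MathematicalPhysics.QuantumFieldTheory.Balaban1983to89.B13Lemma3TorusNonvacuity (numerics_nonvacuous)
open Literature.MathematicalPhysics.QuantumFieldTheory.Balaban1983to89.B12TreeDecay (kappa₀ K₀)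
open Literature.MathematicalPhysics.QuantumFieldTheory.Balaban1983to89.B13Resummation (locE locE_congr)
open Literature.MathematicalPhysics.QuantumFieldTheory.Balaban1983to89.B13FamilySum (Ineq126 VolBound Ineq227)
open Summit.QuantumFields.BalabanUV.T4Continuum.NE1p.DressedOutputAnalytic (analytic_and_bounded_locE_param)

/-! ## §1. The Cauchy step of row NE5: Schwarz's lemma on the parameter disc -/

section Schwarz

variable {F : Type*} [NormedAddCommGroup F] [NormedSpace ℂ F]

/-- **THE ONE-LINE CAUCHY STEP NE5 CONSUMES** (Schwarz's lemma, Mathlib `Complex.dist_le_div_mul_dist_of_mapsTo_ball`):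
a function holomorphic on the disc `‖θ‖ < ρ`, `ρ > 1`, bounded there by `M`, moves by at most `2M∕ρ` between the two
runs `θ = 0` and `θ = 1`.  For NE5: `ρ = s∕r_j` (fixed margin over the two-run rate), so the move is `(2M∕s)·r_j` —
King's *"difference of propagators on one line"* rate (CMP 102 p. 665) read through Cauchy's estimate. [folklore] -/
theorem norm_sub_le_of_pencil {f : ℂ → F} {ρ M : ℝ} (hρ : 1 < ρ) (hf : DifferentiableOn ℂ f (ball (0 : ℂ) ρ))
    (hM : ∀ z ∈ ball (0 : ℂ) ρ, ‖f z‖ ≤ M) : ‖f 1 - f 0‖ ≤ 2 * M / ρ := by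
  have h0 : (0 : ℂ) ∈ ball (0 : ℂ) ρ := mem_ball_self (by linarith)
  have h1 : (1 : ℂ) ∈ ball (0 : ℂ) ρ := by simpa using hρ
  have hmaps : MapsTo f (ball (0 : ℂ) ρ) (closedBall (f 0) (2 * M)) := fun z hz => by
    rw [mem_closedBall, dist_eq_norm]
    calc ‖f z - f 0‖ ≤ ‖f z‖ + ‖f 0‖ := norm_sub_le _ _
      _ ≤ M + M := add_le_add (hM z hz) (hM 0 h0)
      _ = 2 * M := by ring
  have h := Complex.dist_le_div_mul_dist_of_mapsTo_ball hf hmaps h1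
  simpa [dist_eq_norm] using h

/-- **The rescaled difference obeys the same majorant**: `‖(ρ∕2)·(f 1 − f 0)‖ ≤ M` — the form in which a two-run
difference is fed to a ONE-run resummation (Lemma 3, [KP86]) with unchanged letters. [folklore] -/
theorem norm_smul_sub_le_of_pencil {f : ℂ → F} {ρ M : ℝ} (hρ : 1 < ρ) (hf : DifferentiableOn ℂ f (ball (0 : ℂ) ρ))
    (hM : ∀ z ∈ ball (0 : ℂ) ρ, ‖f z‖ ≤ M) : ‖(ρ / 2) • (f 1 - f 0)‖ ≤ M := by
  have hρ0 : 0 < ρ := by linarith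
  have h := norm_sub_le_of_pencil hρ hf hM
  rw [norm_smul, Real.norm_of_nonneg (by positivity)]
  calc ρ / 2 * ‖f 1 - f 0‖ ≤ ρ / 2 * (2 * M / ρ) := by gcongr
    _ = M := by field_simp

/-- **The rate form**: with `ρ = s ∕ r` (`0 < r < s`) the move is `(2M∕s)·r` — linear in the two-run rate `r`, the
constant `2M∕s` free of it (the form of King's Thm 3.4 (3.9), CMP 102 p. 656, in one variable). [folklore] -/
theorem norm_sub_le_rate_of_pencil {f : ℂ → F} {r s M : ℝ} (hr : 0 < r) (hrs : r < s)
    (hf : DifferentiableOn ℂ f (ball (0 : ℂ) (s / r))) (hM : ∀ z ∈ ball (0 : ℂ) (s / r), ‖f z‖ ≤ M) :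
    ‖f 1 - f 0‖ ≤ 2 * M / s * r := by
  have hρ : 1 < s / r := by rwa [lt_div_iff₀ hr, one_mul]
  have h := norm_sub_le_of_pencil hρ hf hM
  calc ‖f 1 - f 0‖ ≤ 2 * M / (s / r) := h
    _ = 2 * M / s * r := by field_simp

end Schwarz

/-! ## §2. Generic E-layer two-run rate over a polymer geometry in the Kotecký–Preiss region -/

section ELayer

variable {Dom Cube : Type*} [DecidableEq Dom] [DecidableEq Cube] [Fintype Dom]
variable (ι : Dom → Dom → Prop) [DecidableRel ι]

/-- **GENERIC E-LAYER TWO-RUN RATE.**  Over any polymer geometry in the [KP86] region (footprint-local incompatibility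
with reach `≤ ν·#cubes`, (1.26) at rate `κ₀` with constant `K₀`, volume bound `c₁`, (2.27) for the covering families of
`X` with constant `c`, the one-run clauses `r₁ + 2κ₀ + 2 ≤ R` and `A e^{b+1} K₀ ν c₁ ≤ 1`, `r₁c ≤ b`): if a PENCIL of
activity families `θ ↦ H^θ(Z)` (`Z ⊆ X`) is holomorphic on the disc `‖θ‖ < ρ`, `ρ > 1`, and obeys the (2.38)-shape
majorant `‖H^θ(Z)‖ ≤ A e^{−R d(Z)}` UNIFORMLY in `θ`, then the X-localized cluster sums (2.13) of the two end members
differ by at most `2∕ρ` times the (2.41) envelope: `‖locE(H^1)(X) − locE(H^0)(X)‖ ≤ (2∕ρ)·e ν c₁ K₀² A e^{−r₁ d(X)}`.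
(`NE1p.DressedOutputAnalytic.analytic_and_bounded_locE_param` at parameter space `ℂ`, then §1.)
[cite: Balaban1988RG2Cluster, (2.13) p.14, (2.39)–(2.41) p.21; KoteckyPreiss1986, Thm 1] -/
theorem norm_locE_sub_le_of_pencil [Std.Refl ι] [Std.Symm ι] {cubes reach : Dom → Finset Cube} {d : Dom → ℝ}
    {act : ℂ → Dom → ℂ} {A R r₁ κ₀ K₀ c₁ c b ν dX ρ : ℝ} {X : Finset Cube} (hρ : 1 < ρ)
    (hloc : ∀ Z Z', ι Z' Z → ∃ q ∈ reach Z, q ∈ cubes Z')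
    (hreach : ∀ Z, ((reach Z).card : ℝ) ≤ ν * (cubes Z).card)
    (hd : ∀ Z, 0 ≤ d Z) (hA : 0 ≤ A) (hK₀ : 0 ≤ K₀) (hc₁ : 0 ≤ c₁) (hν : 0 ≤ ν) (hκ₀ : 0 ≤ κ₀)
    (hr₁ : 0 ≤ r₁) (hc : 0 ≤ c) (hb : r₁ * c ≤ b)
    (h126 : Ineq126 (Finset.univ : Finset Dom) cubes d κ₀ K₀)
    (hvol : VolBound (Finset.univ : Finset Dom) cubes d c₁)
    (h227 : Ineq227 (Finset.univ : Finset Dom) cubes d X dX c)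
    (hrate : r₁ + 2 * κ₀ + 2 ≤ R) (hsmall : A * Real.exp (b + 1) * K₀ * ν * c₁ ≤ 1) (hX : X.Nonempty)
    (hhol : ∀ Z, cubes Z ⊆ X → DifferentiableOn ℂ (fun θ => act θ Z) (ball (0 : ℂ) ρ))
    (hm : ∀ θ ∈ ball (0 : ℂ) ρ, ∀ Z, cubes Z ⊆ X → ‖act θ Z‖ ≤ A * Real.exp (-(R * d Z))) :
    ‖locE ι cubes (act 1) X - locE ι cubes (act 0) X‖ ≤
      2 * (Real.exp 1 * ν * c₁ * K₀ ^ 2 * A * Real.exp (-(r₁ * dX))) / ρ := by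
  obtain ⟨hdiff, hbd⟩ := analytic_and_bounded_locE_param ι (m := fun Z => A * Real.exp (-(R * d Z))) (act := act)
    isOpen_ball hloc hreach hd hA hK₀ hc₁ hν hκ₀ hr₁ hc hb h126 hvol h227 hrate hsmall hX hhol hm (fun Z _ => le_rfl)
  exact norm_sub_le_of_pencil hρ hdiff hbd

end ELayer

/-! ## §3. The two-scale torus model: (2.26) uniform along a holomorphic term pencil ⇒ the two-run rates -/

section Torus

variable {L N' : ℕ} [NeZero L] [NeZero N'] {M : ℕ} [NeZero M]

/-- **(2.38) FOR EVERY PENCIL MEMBER on the torus model.**  If a pencil of (2.14)-term families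
`θ ↦ P Z t φ θ` (`t ∈ terms Z` the concrete torus index set of `B13Lemma3TorusTerms`) obeys (2.26) UNIFORMLY on the
disc `‖θ‖ < ρ` — `‖P Z t φ θ‖ ≤ weight L M c Z a t · e^{a₅|Z|}` on the space `sp2 Z` of p. 15 — then, under the
numerical restrictions of Lemma 3 (verbatim those of `B13Lemma3TorusTerms.bound238_torus_of_226`), every member's
activity `H^θ(Z) := Σ_{t ∈ terms Z} P Z t φ θ` obeys (2.38) AS PRINTED: `‖H^θ(Z)‖ ≤ C₃ε₁e^{−(1−8δ)½Lκ d_{k+1}(Z)}`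
(`bound238_torus_of_226` applied to the step data with activity `H^θ`). [cite: Balaban1988RG2Cluster, Lemma 3 (2.38) p.20, (2.26) p.17] -/
theorem bound238_torus_pencil (c : B13.Consts) (hL : 8 ≤ c.L) (hLc : c.L = L) (W : TwoTorusStep 4 L N')
    (P : (Z : TDom 4 N') → Finset (TDom 4 (L * N')) × Finset (TBond 4 M (L * N')) → W.Φ → ℂ → ℂ)
    {ρ a a₂ a₂' a₅ Aabs : ℝ}
    (h226 : ∀ θ ∈ ball (0 : ℂ) ρ, ∀ (Z : TDom 4 N') (φ : W.Φ), φ ∈ W.sp2 Z → ∀ t ∈ terms L M Z,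
      ‖P Z t φ θ‖ ≤ weight L M c Z a t * Real.exp (a₅ * ((Z.1).card : ℝ)))
    (hα₆ : 0 < c.α₆) (hε₀ : 0 ≤ c.eps2) (hδ : 0 ≤ c.δ) (hδ7 : 0 ≤ 1 - 7 * c.δ) (hκ : 0 ≤ c.κ) (ha : 0 ≤ a)
    (hR15 : c.R15) (hR16 : 18 * ((1 - 4 * c.δ) * c.κ) ≤ a / 20) (hR16' : 4 * c.κ ≤ a / 20)
    (hR17 : Real.exp (-(a / 20)) ≤ c.eps2) (h231 : 2 * (4 : ℝ) * (M : ℝ) ^ 4 * Real.exp (-(a / 10)) ≤ a / 20)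
    (ha₂ : 0 ≤ a₂) (hκ229 : kappa₀ 64 8 + a₂ ≤ c.δ * c.κ)
    (hsm229 : c.α₆ * Real.exp a₂ * K₀ 64 8 * 64 ≤ a₂)
    (habsk : Real.exp (-(a / 20)) * 64 ≤ c.δ * c.κ)
    (h18half : B13Step237.R18half c (K₀ 64 8 * Real.exp (Real.exp (-(a / 20)) * 64)))
    (h18 : B13Step237.R18sharp c (K₀ 64 8 * Real.exp (Real.exp (-(a / 20)) * 64)) ((c.L : ℝ) / 2))
    (ha₂' : 0 ≤ a₂') (hκ229' : kappa₀ 64 8 + a₂' ≤ c.δ * ((c.L : ℝ) / 2) * c.κ)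
    (hsm229' : c.α₆ * Real.exp a₂' * K₀ 64 8 * 64 ≤ a₂')
    (hR20 : 18 * ((1 - 7 * c.δ) * ((c.L : ℝ) / 2) * c.κ) ≤ (c.κ₁ - 1) / 2)
    (ha₅ : 0 ≤ a₅) (habs : a₅ + Real.exp (-((c.κ₁ - 1) / 2)) ≤ Aabs)
    (hAc : Aabs * 64 ≤ c.δ * ((c.L : ℝ) / 2) * c.κ)
    (hC3 : B13Step237.bracketF c (K₀ 64 8 * Real.exp (Real.exp (-(a / 20)) * 64)) / c.α₆ *
      Real.exp (Aabs * 64) ≤ c.C3act * c.ε₁) :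
    ∀ θ ∈ ball (0 : ℂ) ρ, ∀ (Z : TDom 4 N') (φ : W.Φ), φ ∈ W.sp2 Z →
      ‖∑ t ∈ terms L M Z, P Z t φ θ‖ ≤
        c.C3act * c.ε₁ * Real.exp (-((1 - 8 * c.δ) * ((c.L : ℝ) / 2) * c.κ * (tsys 4 N').dj Z)) := by
  intro θ hθ Z φ hφ
  have h := bound238_torus_of_226 c hL hLc { W with H := fun Z φ => ∑ t ∈ terms L M Z, P Z t φ θ }
    (fun Z t φ => P Z t φ θ) (fun Z φ _ => norm_sum_le _ _) (fun Z φ hφ t ht => h226 θ hθ Z φ hφ t ht)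
    hα₆ hε₀ hδ hδ7 hκ ha hR15 hR16 hR16' hR17 h231 ha₂ hκ229 hsm229 habsk h18half h18 ha₂' hκ229' hsm229' hR20 ha₅
    habs hAc hC3
  exact h Z φ hφ

/-- **THE H-LAYER TWO-RUN RATE on the torus model.**  If the two runs' (2.14)-term families are the end members
`P(·,0)`, `P(·,1)` of a pencil holomorphic on the disc `‖θ‖ < ρ`, `ρ > 1`, along which (2.26) holds uniformly, then —
under Lemma 3's restrictions — the activities `H^A(Z) = Σ_t P Z t φ 0`, `H^B(Z) = Σ_t P Z t φ 1` differ on `sp2 Z` by at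
most `(2∕ρ)·C₃ε₁e^{−(1−8δ)½Lκ d_{k+1}(Z)}`: the (2.38) bound times the Schwarz factor `2∕ρ = 2r_j∕s`.
[cite: Balaban1988RG2Cluster, Lemma 3 (2.38) p.20; King1986, p.665] -/
theorem norm_H_sub_le_torus (c : B13.Consts) (hL : 8 ≤ c.L) (hLc : c.L = L) (W : TwoTorusStep 4 L N')
    (P : (Z : TDom 4 N') → Finset (TDom 4 (L * N')) × Finset (TBond 4 M (L * N')) → W.Φ → ℂ → ℂ)
    {ρ a a₂ a₂' a₅ Aabs : ℝ} (hρ : 1 < ρ)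
    (hPhol : ∀ (Z : TDom 4 N') (φ : W.Φ), φ ∈ W.sp2 Z → ∀ t ∈ terms L M Z,
      DifferentiableOn ℂ (P Z t φ) (ball (0 : ℂ) ρ))
    (h226 : ∀ θ ∈ ball (0 : ℂ) ρ, ∀ (Z : TDom 4 N') (φ : W.Φ), φ ∈ W.sp2 Z → ∀ t ∈ terms L M Z,
      ‖P Z t φ θ‖ ≤ weight L M c Z a t * Real.exp (a₅ * ((Z.1).card : ℝ)))
    (hα₆ : 0 < c.α₆) (hε₀ : 0 ≤ c.eps2) (hδ : 0 ≤ c.δ) (hδ7 : 0 ≤ 1 - 7 * c.δ) (hκ : 0 ≤ c.κ) (ha : 0 ≤ a)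
    (hR15 : c.R15) (hR16 : 18 * ((1 - 4 * c.δ) * c.κ) ≤ a / 20) (hR16' : 4 * c.κ ≤ a / 20)
    (hR17 : Real.exp (-(a / 20)) ≤ c.eps2) (h231 : 2 * (4 : ℝ) * (M : ℝ) ^ 4 * Real.exp (-(a / 10)) ≤ a / 20)
    (ha₂ : 0 ≤ a₂) (hκ229 : kappa₀ 64 8 + a₂ ≤ c.δ * c.κ)
    (hsm229 : c.α₆ * Real.exp a₂ * K₀ 64 8 * 64 ≤ a₂)
    (habsk : Real.exp (-(a / 20)) * 64 ≤ c.δ * c.κ)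
    (h18half : B13Step237.R18half c (K₀ 64 8 * Real.exp (Real.exp (-(a / 20)) * 64)))
    (h18 : B13Step237.R18sharp c (K₀ 64 8 * Real.exp (Real.exp (-(a / 20)) * 64)) ((c.L : ℝ) / 2))
    (ha₂' : 0 ≤ a₂') (hκ229' : kappa₀ 64 8 + a₂' ≤ c.δ * ((c.L : ℝ) / 2) * c.κ)
    (hsm229' : c.α₆ * Real.exp a₂' * K₀ 64 8 * 64 ≤ a₂')
    (hR20 : 18 * ((1 - 7 * c.δ) * ((c.L : ℝ) / 2) * c.κ) ≤ (c.κ₁ - 1) / 2)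
    (ha₅ : 0 ≤ a₅) (habs : a₅ + Real.exp (-((c.κ₁ - 1) / 2)) ≤ Aabs)
    (hAc : Aabs * 64 ≤ c.δ * ((c.L : ℝ) / 2) * c.κ)
    (hC3 : B13Step237.bracketF c (K₀ 64 8 * Real.exp (Real.exp (-(a / 20)) * 64)) / c.α₆ *
      Real.exp (Aabs * 64) ≤ c.C3act * c.ε₁)
    {HA HB : TDom 4 N' → W.Φ → ℂ}
    (hHA : ∀ (Z : TDom 4 N') (φ : W.Φ), φ ∈ W.sp2 Z → HA Z φ = ∑ t ∈ terms L M Z, P Z t φ 0)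
    (hHB : ∀ (Z : TDom 4 N') (φ : W.Φ), φ ∈ W.sp2 Z → HB Z φ = ∑ t ∈ terms L M Z, P Z t φ 1) :
    ∀ (Z : TDom 4 N') (φ : W.Φ), φ ∈ W.sp2 Z →
      ‖HB Z φ - HA Z φ‖ ≤
        2 * (c.C3act * c.ε₁ * Real.exp (-((1 - 8 * c.δ) * ((c.L : ℝ) / 2) * c.κ * (tsys 4 N').dj Z))) / ρ := by
  intro Z φ hφ
  have h238 := bound238_torus_pencil c hL hLc W P h226 hα₆ hε₀ hδ hδ7 hκ ha hR15 hR16 hR16' hR17 h231 ha₂ hκ229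
    hsm229 habsk h18half h18 ha₂' hκ229' hsm229' hR20 ha₅ habs hAc hC3
  rw [hHA Z φ hφ, hHB Z φ hφ]
  exact norm_sub_le_of_pencil (f := fun θ => ∑ t ∈ terms L M Z, P Z t φ θ) hρ
    (DifferentiableOn.fun_sum fun t ht => hPhol Z φ hφ t ht) (fun θ hθ => h238 θ hθ Z φ hφ)

open Classical in
/-- **NE5'S INEQUALITY AT ONE PAIRED SCALE ON THE TORUS CARRIER — the E-layer two-run rate.**  Same pencil hypotheses
as `norm_H_sub_le_torus`; in addition each run's `E^{(k+1)}(X)` IS the X-localized cluster sum (2.13) of its activities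
over the torus incompatibility `TTouch` (`h213A`, `h213B`), the spaces restrict (p. 15, `hsp`), and the (2.39)–(2.41)
numbers of `B13Resummation.cammarotaStep_of_KP` hold at the torus constants (ν = 9, c₁ = 64, K₀(64, 8),
κ₀ = 64 log 162; `r₁ = (1−10δ)½Lκ`).  Then on `sp2 X`:
`‖E^B(X) − E^A(X)‖ ≤ (2∕ρ)·A₂C₃ε₁·e^{−(1−10δ)½Lκ d_{k+1}(X)}` — the printed (2.41) envelope times the Schwarz factor; with
`ρ = s∕r_j` this is `|E^{(j),A}(X) − E^{(j+1),B}(X)| ≤ C₅ r_j e^{−κ′d(X)}`, `C₅ = 2A₂C₃ε₁∕s`, i.e. the SHAPE of the typed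
(NOT printed) estimate `T4OutputRate.NE5` at one scale with rows NE2∕NE3's rate `r_j` in place of `θ^j`.  Proof: (2.38) along the pencil
(`bound238_torus_pencil`) restricted to `Z ⊆ X` by `hsp`; §2 over the CONSTRUCTED torus geometry `tgeometry 4 N′`;
`locE_congr` to read the end members as the two runs. [cite: Balaban1988RG2Cluster, (2.13) p.14, (2.38) p.20, (2.41) p.21; King1986, Thm 3.4 p.656, p.665] -/
theorem norm_E_sub_le_torus (c : B13.Consts) (hL : 8 ≤ c.L) (hLc : c.L = L) (W : TwoTorusStep 4 L N')
    (P : (Z : TDom 4 N') → Finset (TDom 4 (L * N')) × Finset (TBond 4 M (L * N')) → W.Φ → ℂ → ℂ)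
    {ρ a a₂ a₂' a₅ Aabs : ℝ} (hρ : 1 < ρ)
    (hPhol : ∀ (Z : TDom 4 N') (φ : W.Φ), φ ∈ W.sp2 Z → ∀ t ∈ terms L M Z,
      DifferentiableOn ℂ (P Z t φ) (ball (0 : ℂ) ρ))
    (h226 : ∀ θ ∈ ball (0 : ℂ) ρ, ∀ (Z : TDom 4 N') (φ : W.Φ), φ ∈ W.sp2 Z → ∀ t ∈ terms L M Z,
      ‖P Z t φ θ‖ ≤ weight L M c Z a t * Real.exp (a₅ * ((Z.1).card : ℝ)))
    (hα₆ : 0 < c.α₆) (hε₀ : 0 ≤ c.eps2) (hδ : 0 ≤ c.δ) (hδ7 : 0 ≤ 1 - 7 * c.δ) (hκ : 0 ≤ c.κ) (ha : 0 ≤ a)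
    (hR15 : c.R15) (hR16 : 18 * ((1 - 4 * c.δ) * c.κ) ≤ a / 20) (hR16' : 4 * c.κ ≤ a / 20)
    (hR17 : Real.exp (-(a / 20)) ≤ c.eps2) (h231 : 2 * (4 : ℝ) * (M : ℝ) ^ 4 * Real.exp (-(a / 10)) ≤ a / 20)
    (ha₂ : 0 ≤ a₂) (hκ229 : kappa₀ 64 8 + a₂ ≤ c.δ * c.κ)
    (hsm229 : c.α₆ * Real.exp a₂ * K₀ 64 8 * 64 ≤ a₂)
    (habsk : Real.exp (-(a / 20)) * 64 ≤ c.δ * c.κ)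
    (h18half : B13Step237.R18half c (K₀ 64 8 * Real.exp (Real.exp (-(a / 20)) * 64)))
    (h18 : B13Step237.R18sharp c (K₀ 64 8 * Real.exp (Real.exp (-(a / 20)) * 64)) ((c.L : ℝ) / 2))
    (ha₂' : 0 ≤ a₂') (hκ229' : kappa₀ 64 8 + a₂' ≤ c.δ * ((c.L : ℝ) / 2) * c.κ)
    (hsm229' : c.α₆ * Real.exp a₂' * K₀ 64 8 * 64 ≤ a₂')
    (hR20 : 18 * ((1 - 7 * c.δ) * ((c.L : ℝ) / 2) * c.κ) ≤ (c.κ₁ - 1) / 2)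
    (ha₅ : 0 ≤ a₅) (habs : a₅ + Real.exp (-((c.κ₁ - 1) / 2)) ≤ Aabs)
    (hAc : Aabs * 64 ≤ c.δ * ((c.L : ℝ) / 2) * c.κ)
    (hC3 : B13Step237.bracketF c (K₀ 64 8 * Real.exp (Real.exp (-(a / 20)) * 64)) / c.α₆ *
      Real.exp (Aabs * 64) ≤ c.C3act * c.ε₁)
    {HA HB : TDom 4 N' → W.Φ → ℂ}
    (hHA : ∀ (Z : TDom 4 N') (φ : W.Φ), φ ∈ W.sp2 Z → HA Z φ = ∑ t ∈ terms L M Z, P Z t φ 0)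
    (hHB : ∀ (Z : TDom 4 N') (φ : W.Φ), φ ∈ W.sp2 Z → HB Z φ = ∑ t ∈ terms L M Z, P Z t φ 1)
    (hsp : ∀ X Z : TDom 4 N', ∀ φ, Z.1 ⊆ X.1 → φ ∈ W.sp2 X → φ ∈ W.sp2 Z)
    {EA EB : TDom 4 N' → W.Φ → ℂ}
    (h213A : ∀ (X : TDom 4 N') (φ : W.Φ), φ ∈ W.sp2 X →
      EA X φ = locE (TTouch (d := 4) (N := N')) (fun Z : TDom 4 N' => Z.1) (fun Z => HA Z φ) X.1)
    (h213B : ∀ (X : TDom 4 N') (φ : W.Φ), φ ∈ W.sp2 X →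
      EB X φ = locE (TTouch (d := 4) (N := N')) (fun Z : TDom 4 N' => Z.1) (fun Z => HB Z φ) X.1)
    (hAct : 0 ≤ c.C3act * c.ε₁) (hr₁ : 0 ≤ (1 - 10 * c.δ) * ((c.L : ℝ) / 2) * c.κ)
    (hlarge : (1 - 10 * c.δ) * ((c.L : ℝ) / 2) * c.κ + 2 * (64 * Real.log 162) + 2 ≤
      (1 - 8 * c.δ) * ((c.L : ℝ) / 2) * c.κ)
    (hsmall : c.C3act * c.ε₁ * Real.exp (5 * ((1 - 10 * c.δ) * ((c.L : ℝ) / 2) * c.κ) + 1) * K₀ 64 8 * 9 * 64 ≤ 1)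
    (hA₂ : Real.exp 1 * 9 * 64 * K₀ 64 8 ^ 2 ≤ c.A₂) :
    ∀ (X : TDom 4 N') (φ : W.Φ), φ ∈ W.sp2 X →
      ‖EB X φ - EA X φ‖ ≤
        2 * (c.A₂ * c.C3act * c.ε₁ *
          Real.exp (-((1 - 10 * c.δ) * ((c.L : ℝ) / 2) * c.κ * (tsys 4 N').dj X))) / ρ := by
  intro X φ hφ
  have hρ0 : 0 < ρ := by linarith
  have h238 := bound238_torus_pencil c hL hLc W P h226 hα₆ hε₀ hδ hδ7 hκ ha hR15 hR16 hR16' hR17 h231 ha₂ hκ229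
    hsm229 habsk h18half h18 ha₂' hκ229' hsm229' hR20 ha₅ habs hAc hC3
  -- the constructed polymer geometry of 𝐃_{k+1} on the torus and its d = 4 constants
  set G := tgeometry 4 N' with hG
  haveI : Std.Refl (TTouch (d := 4) (N := N')) := ⟨G.ι_refl⟩
  haveI : Std.Symm (TTouch (d := 4) (N := N')) := ⟨G.ι_symm⟩
  have hGν : G.ν = 9 := (tgeometry_consts_four N').1
  have hGκ₀ : G.κ₀ = 64 * Real.log 162 := (tgeometry_consts_four N').2.1
  have hGc₁ : G.c₁ = 64 := (tgeometry_consts_four N').2.2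
  have hGK₀ : G.K₀ = K₀ 64 8 := by
    show K₀ (4 * 2 ^ 4) (2 * 4) = K₀ 64 8
    norm_num
  -- the pencil of activities at the configuration `φ`
  set act : ℂ → TDom 4 N' → ℂ := fun θ Z => ∑ t ∈ terms L M Z, P Z t φ θ with hact
  have hhol : ∀ Z : TDom 4 N', Z.1 ⊆ X.1 → DifferentiableOn ℂ (fun θ => act θ Z) (ball (0 : ℂ) ρ) :=
    fun Z hZ => DifferentiableOn.fun_sum fun t ht => hPhol Z φ (hsp X Z φ hZ hφ) t ht
  have hm : ∀ θ ∈ ball (0 : ℂ) ρ, ∀ Z : TDom 4 N', Z.1 ⊆ X.1 → ‖act θ Z‖ ≤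
      c.C3act * c.ε₁ * Real.exp (-((1 - 8 * c.δ) * ((c.L : ℝ) / 2) * c.κ * (tsys 4 N').dj Z)) :=
    fun θ hθ Z hZ => h238 θ hθ Z φ (hsp X Z φ hZ hφ)
  have key := norm_locE_sub_le_of_pencil (TTouch (d := 4) (N := N')) (cubes := fun Z : TDom 4 N' => Z.1)
    (reach := G.reach) (d := (tsys 4 N').dj) (act := act) (A := c.C3act * c.ε₁)
    (R := (1 - 8 * c.δ) * ((c.L : ℝ) / 2) * c.κ) (r₁ := (1 - 10 * c.δ) * ((c.L : ℝ) / 2) * c.κ)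
    (κ₀ := G.κ₀) (K₀ := G.K₀) (c₁ := G.c₁) (c := 5) (b := 5 * ((1 - 10 * c.δ) * ((c.L : ℝ) / 2) * c.κ))
    (ν := G.ν) (dX := (tsys 4 N').dj X) (X := X.1) hρ G.loc G.reach_le (tsys 4 N').dj_nonneg hAct G.K₀_nonneg
    G.c₁_nonneg G.ν_nonneg G.κ₀_nonneg hr₁ (by norm_num) (le_of_eq (by ring)) G.ineq126 G.volBound (G.ineq227 X)
    (by rw [hGκ₀]; exact hlarge) (by rw [hGK₀, hGν, hGc₁]; exact hsmall) (G.cubes_nonempty X) hhol hm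
  -- read the end members as the two runs
  have hE0 : locE (TTouch (d := 4) (N := N')) (fun Z : TDom 4 N' => Z.1) (act 0) X.1 = EA X φ := by
    rw [h213A X φ hφ]
    exact locE_congr _ fun Z hZ => (hHA Z φ (hsp X Z φ hZ hφ)).symm
  have hE1 : locE (TTouch (d := 4) (N := N')) (fun Z : TDom 4 N' => Z.1) (act 1) X.1 = EB X φ := by
    rw [h213B X φ hφ]
    exact locE_congr _ fun Z hZ => (hHB Z φ (hsp X Z φ hZ hφ)).symm
  rw [hE0, hE1, hGν, hGc₁, hGK₀] at key
  set Ex := Real.exp (-((1 - 10 * c.δ) * ((c.L : ℝ) / 2) * c.κ * (tsys 4 N').dj X)) with hEx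
  have hEx0 : 0 ≤ Ex := Real.exp_nonneg _
  have h1 : Real.exp 1 * 9 * 64 * K₀ 64 8 ^ 2 * (c.C3act * c.ε₁) * Ex ≤ c.A₂ * (c.C3act * c.ε₁) * Ex :=
    mul_le_mul_of_nonneg_right (mul_le_mul_of_nonneg_right hA₂ hAct) hEx0
  calc ‖EB X φ - EA X φ‖ ≤ 2 * (Real.exp 1 * 9 * 64 * K₀ 64 8 ^ 2 * (c.C3act * c.ε₁) * Ex) / ρ := key
    _ ≤ 2 * (c.A₂ * (c.C3act * c.ε₁) * Ex) / ρ := by gcongr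
    _ = 2 * (c.A₂ * c.C3act * c.ε₁ * Ex) / ρ := by ring

/-- **The numerical side conditions are jointly satisfiable** (so `norm_E_sub_le_torus` is not vacuous on its numeric
side): some constants `c` with `c.L ≥ 8`, a cube side `M > 0` and reals `a, a₂, a₂′, a₅, Aabs` satisfy every numerical
hypothesis of `norm_E_sub_le_torus` — Lemma 3's restrictions verbatim and the (2.39)–(2.41) numbers with the general
exponent `5(1−10δ)½Lκ + 1` — by the tree witness `B13Lemma3TorusNonvacuity.numerics_nonvacuous` (L = 8, δ = 3∕40, so
R22 `(1−10δ)½L = 1` turns `(1−10δ)½Lκ` into `κ`). [cite: Balaban1988RG2Cluster, Lemma 3 p.20, p.21 (after (2.41))] -/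
theorem numerics_nonvacuous_pencil :
    ∃ (c : B13.Consts) (M : ℕ) (a a₂ a₂' a₅ Aabs : ℝ),
      8 ≤ c.L ∧ 0 < M ∧ 0 < c.ε₁ ∧ 0 < c.α₆ ∧ 0 ≤ c.eps2 ∧ 0 ≤ c.δ ∧ 0 ≤ 1 - 7 * c.δ ∧ 0 ≤ c.κ ∧ 0 ≤ a ∧
      c.R15 ∧ 18 * ((1 - 4 * c.δ) * c.κ) ≤ a / 20 ∧ 4 * c.κ ≤ a / 20 ∧ Real.exp (-(a / 20)) ≤ c.eps2 ∧
      2 * (4 : ℝ) * (M : ℝ) ^ 4 * Real.exp (-(a / 10)) ≤ a / 20 ∧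
      0 ≤ a₂ ∧ kappa₀ 64 8 + a₂ ≤ c.δ * c.κ ∧ c.α₆ * Real.exp a₂ * K₀ 64 8 * 64 ≤ a₂ ∧
      Real.exp (-(a / 20)) * 64 ≤ c.δ * c.κ ∧
      B13Step237.R18half c (K₀ 64 8 * Real.exp (Real.exp (-(a / 20)) * 64)) ∧
      B13Step237.R18sharp c (K₀ 64 8 * Real.exp (Real.exp (-(a / 20)) * 64)) ((c.L : ℝ) / 2) ∧
      0 ≤ a₂' ∧ kappa₀ 64 8 + a₂' ≤ c.δ * ((c.L : ℝ) / 2) * c.κ ∧ c.α₆ * Real.exp a₂' * K₀ 64 8 * 64 ≤ a₂' ∧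
      18 * ((1 - 7 * c.δ) * ((c.L : ℝ) / 2) * c.κ) ≤ (c.κ₁ - 1) / 2 ∧
      0 ≤ a₅ ∧ a₅ + Real.exp (-((c.κ₁ - 1) / 2)) ≤ Aabs ∧ Aabs * 64 ≤ c.δ * ((c.L : ℝ) / 2) * c.κ ∧
      B13Step237.bracketF c (K₀ 64 8 * Real.exp (Real.exp (-(a / 20)) * 64)) / c.α₆ * Real.exp (Aabs * 64) ≤
        c.C3act * c.ε₁ ∧
      0 ≤ c.C3act * c.ε₁ ∧ 0 ≤ (1 - 10 * c.δ) * ((c.L : ℝ) / 2) * c.κ ∧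
      (1 - 10 * c.δ) * ((c.L : ℝ) / 2) * c.κ + 2 * (64 * Real.log 162) + 2 ≤ (1 - 8 * c.δ) * ((c.L : ℝ) / 2) * c.κ ∧
      c.C3act * c.ε₁ * Real.exp (5 * ((1 - 10 * c.δ) * ((c.L : ℝ) / 2) * c.κ) + 1) * K₀ 64 8 * 9 * 64 ≤ 1 ∧
      Real.exp 1 * 9 * 64 * K₀ 64 8 ^ 2 ≤ c.A₂ := by
  obtain ⟨c, M, a, a₂, a₂', a₅, Aabs, Bc, hL, hM, hε₁, hα₆, hε₀, hδ, hδ7, hκ, ha, hR15, hR16, hR16', hR17, h231, ha₂,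
    hκ229, hsm229, habsk, h18half, h18, ha₂', hκ229', hsm229', hR20, ha₅, habs, hAc, hC3, hAct, hlarge, hsmall, hA₂,
    hR22, -, -, -, -, -⟩ := numerics_nonvacuous
  have h22 : (1 - 10 * c.δ) * ((c.L : ℝ) / 2) = 1 := hR22
  have hr : (1 - 10 * c.δ) * ((c.L : ℝ) / 2) * c.κ = c.κ := by rw [h22, one_mul]
  refine ⟨c, M, a, a₂, a₂', a₅, Aabs, hL, hM, hε₁, hα₆, hε₀, hδ, hδ7, hκ, ha, hR15, hR16, hR16', hR17, h231, ha₂, hκ229,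
    hsm229, habsk, h18half, h18, ha₂', hκ229', hsm229', hR20, ha₅, habs, hAc, hC3, hAct, ?_, ?_, ?_, hA₂⟩
  · rw [hr]; exact hκ
  · rw [hr]; exact hlarge
  · rw [hr]; exact hsmall

end Torus

end Summit.QuantumFields.BalabanUV.T4Continuum.Spine.NE5.TwoRunTorusRate

end
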